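import Summits.AtomisticToContinuum.Crystallization.Theorems.FrustratedLawDichotomyStrainedPatchHomExteriorChain

/-!
# PIECEWISE-CONSTANT CURVATURE FLOORS ALONG ONE RAY: the clamp antiderivative and the assembled exterior force bound from FINITELY MANY box certificates
# (27623 `(H) HomFloor`, hcp half; hand-1 g39; critic row 1470 (A4)/(A5): E2′ nested exterior and the chained annulus (β) WITHOUT any new kit soundness)

decomp-a2c hand-1 g39 (crux `AperiodicFrustratedLawGap`, stmt-AtomisticToContinuum-27623).  `…HomExteriorChain` transports a curvature floor certified on a box containing a
sub-segment `[θ_k, θ_{k+1}]` of the ray to the original ray (`floor_transport`) and integrates any floor profile with a continuous, piecewise-differentiable antiderivative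
(`slope_growth_of_curvature_pw`).  This file supplies the ONE concrete antiderivative every chain needs and the assembled statements:

* §1 the clamp `pieceLen a b s := max a (min s b) − a` (length of `[a, b] ∩ (−∞, s]` for `a ≤ b`): continuity, value `0` at `s ≤ a`, value `b − a` at `s ≥ b`, and
  `HasDerivAt (pieceLen a b) 1 s` on `(a, b)`, `HasDerivAt (pieceLen a b) 0 s` off `[a, b]`;
* §2 ★ `hcpForce_growth_pieces` — floors `ℓ k‖Δ‖²` on the pieces `(θ k, θ (k+1))` (`k < m`, `θ 0 = 0`, `θ m = 1`, `θ` monotone) ⟹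
  `Σ segG … 0 + (Σ_{k<m} ℓ k (θ (k+1) − θ k))‖Δ‖² ≤ Σ segG … 1` for the hcp B-family and any regular profile;
* §3 ★★ `hcpForceLJ_exterior_pieces` (kernel form at the target) and ★★★ `hver_of_slabParts_pieces` — the `hver` conclusion of a slab leaf whose exterior is certified by a
  finite chain of box floors (nested boxes around the cell = E2′, or off-sheet annulus boxes = (β)), via `…HomExteriorTaylor.hver_of_slabParts_of_targetForce`.

How E3 uses it: for each box `B_k` of the chain the kernel fact `curvCheckLJM … = true` gives (`curvLJ_floorM_of_check` at the two points `ξ₀ + θ_k(ξ − ξ₀)`,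
`ξ₀ + θ_{k+1}(ξ − ξ₀)` of `B_k`, then `floor_transport` with `s₁ = θ_k`, `t = θ_{k+1} − θ_k`) exactly the hypothesis `hfloor k` below.

One definition (`pieceLen`, a real clamp); 0 sorry; standard axioms; no instances / notation / `#eval`.  `--supports stmt-AtomisticToContinuum-27623`.
-/

noncomputable section

namespace Summit.AtomisticToContinuum.Crystallization.Theorems.FrustratedLawDichotomyStrainedPatchHomExteriorTaylor

open scoped BigOperators RealInnerProductSpace
open Literature.Analysis.ValidatedNumerics.Numerics
open Summit.AtomisticToContinuum.Crystallization.Theorems.ChargedEnergyGapNegative (E3)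
open Summit.AtomisticToContinuum.Crystallization.Theorems.FrustratedLawDichotomySchurCut (effPot w₄₅ ω₄)
open Summit.AtomisticToContinuum.Crystallization.Theorems.FrustratedLawDichotomyAveragingRuleTightFree (TightNearCap BadNearCap)
open Summit.AtomisticToContinuum.Crystallization.Theorems.FrustratedLawDichotomyExemptAbsorption (ExemptNear)
open Summit.AtomisticToContinuum.Crystallization.Theorems.FrustratedLawDichotomyStrainedPatchHomSplit (ExRec latPt hexFrame hcpShift)
open Summit.AtomisticToContinuum.Crystallization.Theorems.FrustratedLawDichotomyStrainedPatchTaylorChord (segR segN segS segG segGd)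
open Summit.AtomisticToContinuum.Crystallization.Theorems.FrustratedLawDichotomyStrainedPatchHomConvexSegment (norm_shuffle_segment_le)
open Summit.AtomisticToContinuum.Crystallization.Theorems.FrustratedLawDichotomyStrainedPatchHomLatticeBoxHcp (norm_shifted_gt)
open Summit.AtomisticToContinuum.Crystallization.Theorems.FrustratedLawDichotomyStrainedPatchHomForceRing
  (segG_of_zero continuousOn_ljProfile hasDerivAt_ljProfile segG_ljProfile_one segG_ljProfile_zero)

/-! ## §1. The clamp antiderivative of one piece -/

/-- Length of `[a, b] ∩ (−∞, s]` (for `a ≤ b`): the antiderivative of the indicator of the piece `(a, b)`. -/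
def pieceLen (a b s : ℝ) : ℝ := max a (min s b) - a

/-- The clamp is continuous. [formal bookkeeping] -/
theorem continuous_pieceLen (a b : ℝ) : Continuous (pieceLen a b) := by
  unfold pieceLen
  fun_prop

/-- Below the piece the clamp vanishes. [arithmetic] -/
theorem pieceLen_of_le_left {a b s : ℝ} (h : s ≤ a) : pieceLen a b s = 0 := by
  unfold pieceLen
  have : min s b ≤ a := (min_le_left s b).trans h
  rw [max_eq_left this, sub_self]

/-- Above the piece the clamp is the full length. [arithmetic] -/
theorem pieceLen_of_right_le {a b s : ℝ} (hab : a ≤ b) (h : b ≤ s) : pieceLen a b s = b - a := by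
  unfold pieceLen
  rw [min_eq_right h, max_eq_right hab]

/-- Inside the piece the clamp is `s − a`. [arithmetic] -/
theorem pieceLen_of_mem {a b s : ℝ} (ha : a ≤ s) (hb : s ≤ b) : pieceLen a b s = s - a := by
  unfold pieceLen
  rw [min_eq_left hb, max_eq_right ha]

/-- Inside the open piece the clamp has derivative `1`. [calculus] -/
theorem hasDerivAt_pieceLen_inside {a b s : ℝ} (ha : a < s) (hb : s < b) : HasDerivAt (pieceLen a b) 1 s := by
  have hev : (fun t => t - a) =ᶠ[nhds s] pieceLen a b := by
    filter_upwards [Ioo_mem_nhds ha hb] with t ht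
    rw [pieceLen_of_mem ht.1.le ht.2.le]
  exact ((hasDerivAt_id s).sub_const a).congr_of_eventuallyEq hev.symm

/-- Strictly below the piece the clamp has derivative `0`. [calculus] -/
theorem hasDerivAt_pieceLen_below {a b s : ℝ} (h : s < a) : HasDerivAt (pieceLen a b) 0 s := by
  have hev : (fun _ => (0 : ℝ)) =ᶠ[nhds s] pieceLen a b := by
    filter_upwards [Iio_mem_nhds h] with t ht
    rw [pieceLen_of_le_left (le_of_lt ht)]
  exact (hasDerivAt_const s (0 : ℝ)).congr_of_eventuallyEq hev.symm

/-- Strictly above the piece the clamp has derivative `0`. [calculus] -/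
theorem hasDerivAt_pieceLen_above {a b s : ℝ} (hab : a ≤ b) (h : b < s) : HasDerivAt (pieceLen a b) 0 s := by
  have hev : (fun _ => (b - a : ℝ)) =ᶠ[nhds s] pieceLen a b := by
    filter_upwards [Ioi_mem_nhds h] with t ht
    rw [pieceLen_of_right_le hab (le_of_lt ht)]
  exact (hasDerivAt_const s (b - a : ℝ)).congr_of_eventuallyEq hev.symm

/-- The indicator value of the piece at a point off its end points. -/
def pieceInd (a b s : ℝ) : ℝ := if a < s ∧ s < b then 1 else 0

/-- Off the end points the clamp has derivative the indicator. [calculus] -/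
theorem hasDerivAt_pieceLen {a b s : ℝ} (hab : a ≤ b) (hsa : s ≠ a) (hsb : s ≠ b) : HasDerivAt (pieceLen a b) (pieceInd a b s) s := by
  unfold pieceInd
  by_cases h1 : a < s
  · by_cases h2 : s < b
    · rw [if_pos ⟨h1, h2⟩]; exact hasDerivAt_pieceLen_inside h1 h2
    · rw [if_neg (fun h => h2 h.2)]
      exact hasDerivAt_pieceLen_above hab (lt_of_le_of_ne (not_lt.1 h2) (Ne.symm hsb))
  · rw [if_neg (fun h => h1 h.1)]
    exact hasDerivAt_pieceLen_below (lt_of_le_of_ne (not_lt.1 h1) hsa)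

/-! ## §2. Growth of the hcp B-family force under a finite chain of box floors -/

/-- ★ **RADIAL GROWTH UNDER PIECEWISE-CONSTANT FLOORS** (hcp B-family, any regular force profile): break points `θ 0 = 0 ≤ θ 1 ≤ … ≤ θ m = 1`, floors
`ℓ k · ‖Δ‖² ≤ Σ_b segGd …  s` for `s ∈ (θ k, θ (k+1))`, `k < m` ⟹ `Σ segG … 0 + (Σ_{k<m} ℓ k (θ (k+1) − θ k))·‖Δ‖² ≤ Σ segG … 1`. [folklore chaining:
`slope_growth_of_curvature_pw` with `K = (Σ_k ℓ k · pieceLen (θ k) (θ (k+1)))·‖Δ‖²`, break set `{θ k}`] -/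
theorem hcpForce_growth_pieces (B : Finset (Fin 3 → ℤ)) {U : E3 →L[ℝ] E3} (hU : ‖U - 1‖ ≤ 1 / 4) {ξ₀ ξ : E3} (hξ₀ : ‖ξ₀‖ ≤ 1 / 4) (hξ : ‖ξ‖ ≤ 1 / 4)
    {W₁ : ℝ → ℝ} (hcont : ContinuousOn W₁ (Set.Ici (3 / 8))) (hdiff : ∀ r, (3 : ℝ) / 8 < r → HasDerivAt W₁ (deriv W₁ r) r)
    (m : ℕ) (θ ℓ : ℕ → ℝ) (hθ0 : θ 0 = 0) (hθm : θ m = 1) (hmono : ∀ k, k < m → θ k ≤ θ (k + 1))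
    (hfloor : ∀ k, k < m → ∀ s ∈ Set.Ioo (θ k) (θ (k + 1)),
      ℓ k * ‖U (ξ - ξ₀)‖ ^ 2 ≤ ∑ bb ∈ B, segGd W₁ (latPt U hexFrame bb + U (hcpShift + ξ₀)) (U (ξ - ξ₀)) s) :
    ∑ bb ∈ B, segG W₁ (latPt U hexFrame bb + U (hcpShift + ξ₀)) (U (ξ - ξ₀)) 0 + (∑ k ∈ Finset.range m, ℓ k * (θ (k + 1) - θ k)) * ‖U (ξ - ξ₀)‖ ^ 2 ≤
      ∑ bb ∈ B, segG W₁ (latPt U hexFrame bb + U (hcpShift + ξ₀)) (U (ξ - ξ₀)) 1 := by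
  classical
  -- monotonicity of the break points in the large
  have hθle : ∀ i j, i ≤ j → j ≤ m → θ i ≤ θ j := by
    intro i j hij hjm
    induction j with
    | zero => simp at hij; subst hij; exact le_rfl
    | succ j ih =>
      rcases Nat.eq_or_lt_of_le hij with h | h
      · subst h; exact le_rfl
      · exact (ih (Nat.lt_succ_iff.1 h) (Nat.le_of_succ_le hjm)).trans (hmono j (Nat.lt_of_succ_le hjm))
  have hθ0le : ∀ k, k ≤ m → 0 ≤ θ k := fun k hk => hθ0 ▸ hθle 0 k (Nat.zero_le k) hk
  have hθle1 : ∀ k, k ≤ m → θ k ≤ 1 := fun k hk => hθm ▸ hθle k m hk le_rfl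
  by_cases hΔ : U (ξ - ξ₀) = 0
  · -- degenerate direction
    simp [hΔ, segG_of_zero]
  set n2 : ℝ := ‖U (ξ - ξ₀)‖ ^ 2 with hn2
  -- the antiderivative and the floor profile
  set K : ℝ → ℝ := fun s => (∑ k ∈ Finset.range m, ℓ k * pieceLen (θ k) (θ (k + 1)) s) * n2 with hK
  set κ : ℝ → ℝ := fun s => (∑ k ∈ Finset.range m, ℓ k * pieceInd (θ k) (θ (k + 1)) s) * n2 with hκ
  set T : Finset ℝ := (Finset.range (m + 1)).image θ with hT
  have hK0 : K 0 = 0 := by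
    have : ∀ k ∈ Finset.range m, ℓ k * pieceLen (θ k) (θ (k + 1)) 0 = 0 := by
      intro k hk
      rw [pieceLen_of_le_left (hθ0le k (Finset.mem_range.1 hk).le), mul_zero]
    simp only [hK, Finset.sum_eq_zero this, zero_mul]
  have hKc : ContinuousOn K (Set.Icc 0 1) := by
    have : Continuous K := by
      simp only [hK]
      exact (continuous_finsetSum _ fun k _ => continuous_const.mul (continuous_pieceLen (θ k) (θ (k + 1)))).mul continuous_const
    exact this.continuousOn
  have hKd : ∀ s, s ∉ T → HasDerivAt K (κ s) s := by
    intro s hsT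
    have hne : ∀ k, k ≤ m → s ≠ θ k := by
      intro k hk heq
      exact hsT (Finset.mem_image.2 ⟨k, Finset.mem_range.2 (Nat.lt_succ_of_le hk), heq.symm⟩)
    have hsum : HasDerivAt (fun t => ∑ k ∈ Finset.range m, ℓ k * pieceLen (θ k) (θ (k + 1)) t)
        (∑ k ∈ Finset.range m, ℓ k * pieceInd (θ k) (θ (k + 1)) s) s := by
      refine HasDerivAt.fun_sum fun k hk => ?_
      have hkm := Finset.mem_range.1 hk
      exact (hasDerivAt_pieceLen (hmono k hkm) (hne k hkm.le) (hne (k + 1) hkm)).const_mul (ℓ k)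
    simpa [hK, hκ] using hsum.mul_const n2
  -- the floor profile is a valid floor at every parameter off the break points (and trivially ≤ the sum when no piece is active? no: we prove κ ≤ Σ segGd on (0,1) \ T)
  have hfloorκ : ∀ s ∈ Set.Ioo (0 : ℝ) 1, s ∉ T →
      κ s ≤ ∑ bb ∈ B, segGd W₁ (latPt U hexFrame bb + U (hcpShift + ξ₀)) (U (ξ - ξ₀)) s := by
    intro s hs hsT
    have hne : ∀ k, k ≤ m → s ≠ θ k := by
      intro k hk heq
      exact hsT (Finset.mem_image.2 ⟨k, Finset.mem_range.2 (Nat.lt_succ_of_le hk), heq.symm⟩)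
    -- locate the piece containing `s`: the largest `k ≤ m` with `θ k < s` is `< m`, and `s < θ (k+1)`
    have hex : ∃ k, k < m ∧ θ k < s ∧ s < θ (k + 1) := by
      by_contra hno
      push Not at hno
      -- by induction every θ k < s for k ≤ m, contradicting θ m = 1 > s
      have hall : ∀ k, k ≤ m → θ k < s := by
        intro k hk
        induction k with
        | zero => rw [hθ0]; exact hs.1
        | succ k ih =>
          have hk' : k < m := Nat.lt_of_succ_le hk
          have h1 := ih hk'.le
          have h2 := hno k hk' h1
          exact lt_of_le_of_ne h2 (Ne.symm (hne (k + 1) hk))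
      have := hall m le_rfl
      rw [hθm] at this
      exact absurd this (not_lt.2 hs.2.le)
    obtain ⟨k₀, hk₀m, hk₀a, hk₀b⟩ := hex
    -- the indicator sum equals ℓ k₀
    have hind : ∀ k ∈ Finset.range m, ℓ k * pieceInd (θ k) (θ (k + 1)) s = if k = k₀ then ℓ k₀ else 0 := by
      intro k hk
      have hkm := Finset.mem_range.1 hk
      by_cases hkk : k = k₀
      · subst hkk; simp [pieceInd, hk₀a, hk₀b]
      · rw [if_neg hkk]
        have hnot : ¬(θ k < s ∧ s < θ (k + 1)) := by
          rintro ⟨h1, h2⟩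
          rcases lt_or_gt_of_ne hkk with hlt | hgt
          · -- k < k₀: θ (k+1) ≤ θ k₀ < s
            have := hθle (k + 1) k₀ hlt hk₀m.le
            linarith
          · -- k₀ < k: s < θ (k₀+1) ≤ θ k
            have := hθle (k₀ + 1) k hgt hkm.le
            linarith
        simp [pieceInd, hnot]
    have hκs : κ s = ℓ k₀ * n2 := by
      simp only [hκ]
      rw [Finset.sum_congr rfl hind, Finset.sum_ite_eq' (Finset.range m) k₀ (fun _ => ℓ k₀), if_pos (Finset.mem_range.2 hk₀m)]
    rw [hκs]
    exact hfloor k₀ hk₀m s ⟨hk₀a, hk₀b⟩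
  -- run the piecewise growth lemma through the hcp tube set-up (as in `hcpForce_growth_fn`)
  set p : (Fin 3 → ℤ) → E3 := fun bb => latPt U hexFrame bb + U (hcpShift + ξ₀) with hp
  set Δ : E3 := U (ξ - ξ₀) with hΔdef
  set bhi : ℝ := (∑ bb ∈ B, ‖p bb‖) + ‖Δ‖ + 1 with hbhi
  have hseg : ∀ bb : Fin 3 → ℤ, ∀ s : ℝ, p bb + s • Δ = latPt U hexFrame bb + U (hcpShift + (ξ₀ + s • (ξ - ξ₀))) := by
    intro bb s
    simp only [hp, hΔdef, map_add, map_smul]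
    abel
  have htube : ∀ bb ∈ B, ∀ s ∈ Set.Icc (0 : ℝ) 1, 3 / 8 ≤ ‖p bb + s • Δ‖ ∧ ‖p bb + s • Δ‖ ≤ bhi := by
    intro bb hbb s hs
    constructor
    · rw [hseg]
      exact (norm_shifted_gt hU (norm_shuffle_segment_le hξ₀ hξ hs) bb).le
    · have h1 : ‖p bb + s • Δ‖ ≤ ‖p bb‖ + ‖Δ‖ := by
        calc ‖p bb + s • Δ‖ ≤ ‖p bb‖ + ‖s • Δ‖ := norm_add_le _ _
          _ ≤ ‖p bb‖ + ‖Δ‖ := by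
              rw [norm_smul, Real.norm_eq_abs, abs_of_nonneg hs.1]
              nlinarith [norm_nonneg Δ, hs.2]
      have h2 : ‖p bb‖ ≤ ∑ bb ∈ B, ‖p bb‖ := Finset.single_le_sum (fun _ _ => norm_nonneg _) hbb
      rw [hbhi]; linarith
  have ha : (0 : ℝ) < 3 / 8 := by norm_num
  have hcont' : ContinuousOn W₁ (Set.Icc (3 / 8) bhi) := hcont.mono fun r hr => hr.1
  have hdiff' : ∀ r, (3 : ℝ) / 8 < r → r < bhi → r ∉ (∅ : Finset ℝ) → HasDerivAt W₁ (deriv W₁ r) r := fun r hr _ _ => hdiff r hr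
  -- the floor hypothesis in the shape of `slope_growth_of_curvature_pw`: at break points we have no floor, so we enlarge the exceptional parameters by `T` through `κ'`
  -- trick: use κ' := κ off T and := (the sum itself) on T, so the floor holds everywhere; K's derivative hypothesis is only required off T.
  set κ' : ℝ → ℝ := fun s => if s ∈ T then ∑ bb ∈ B, segGd W₁ (p bb) Δ s else κ s with hκ'
  have hKd' : ∀ s, s ∉ T → HasDerivAt K (κ' s) s := by
    intro s hsT
    have := hKd s hsT
    simp only [hκ', if_neg hsT]
    exact this
  have hcurv' : ∀ s ∈ Set.Ioo (0 : ℝ) 1, (∀ bb ∈ B, 3 / 8 < segR (p bb) Δ s ∧ segR (p bb) Δ s < bhi ∧ segR (p bb) Δ s ∉ (∅ : Finset ℝ)) →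
      κ' s ≤ ∑ bb ∈ B, segGd W₁ (p bb) Δ s := by
    intro s hs _
    by_cases hsT : s ∈ T
    · simp only [hκ', if_pos hsT]; exact le_rfl
    · simp only [hκ', if_neg hsT]; exact hfloorκ s hs hsT
  have hgrow := slope_growth_of_curvature_pw B p hΔ ∅ T ha hcont' hdiff' htube hK0 hKc hKd' hcurv' 1 ⟨zero_le_one, le_rfl⟩
  -- evaluate K 1
  have hK1 : K 1 = (∑ k ∈ Finset.range m, ℓ k * (θ (k + 1) - θ k)) * n2 := by
    simp only [hK]
    congr 1
    refine Finset.sum_congr rfl fun k hk => ?_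
    have hkm := Finset.mem_range.1 hk
    rw [pieceLen_of_right_le (hmono k hkm) (hθle1 (k + 1) hkm)]
  rw [hK1] at hgrow
  exact hgrow

/-! ## §3. The exterior force bound and the `hver` conclusion from a chain of box floors -/

/-- ★★ **EXTERIOR FORCE BOUND FROM A CHAIN OF BOX FLOORS, LENNARD-JONES `B`-FAMILY, KERNEL FORM**: with the piecewise floors of §2 for the LJ profile and the
reference bound `f₀`: `((Σ_{k<m} ℓ k (θ (k+1) − θ k))‖Δ‖ − f₀)‖Δ‖ ≤ Σ_b (‖X_b‖⁻⁸ − ‖X_b‖⁻¹⁴)⟪X_b, Δ⟫` at the target. [folklore chaining] -/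
theorem hcpForceLJ_exterior_pieces (B : Finset (Fin 3 → ℤ)) {U : E3 →L[ℝ] E3} (hU : ‖U - 1‖ ≤ 1 / 4) {ξ₀ ξ : E3} (hξ₀ : ‖ξ₀‖ ≤ 1 / 4) (hξ : ‖ξ‖ ≤ 1 / 4)
    (m : ℕ) (θ ℓ : ℕ → ℝ) (hθ0 : θ 0 = 0) (hθm : θ m = 1) (hmono : ∀ k, k < m → θ k ≤ θ (k + 1)) {f₀ : ℝ}
    (hfloor : ∀ k, k < m → ∀ s ∈ Set.Ioo (θ k) (θ (k + 1)), ℓ k * ‖U (ξ - ξ₀)‖ ^ 2 ≤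
      ∑ bb ∈ B, segGd (fun x : ℝ => x⁻¹ ^ 7 - x⁻¹ ^ 13) (latPt U hexFrame bb + U (hcpShift + ξ₀)) (U (ξ - ξ₀)) s)
    (hf₀ : |∑ bb ∈ B, (‖latPt U hexFrame bb + U (hcpShift + ξ₀)‖⁻¹ ^ 8 - ‖latPt U hexFrame bb + U (hcpShift + ξ₀)‖⁻¹ ^ 14) *
        ⟪latPt U hexFrame bb + U (hcpShift + ξ₀), U (ξ - ξ₀)⟫| ≤ f₀ * ‖U (ξ - ξ₀)‖) :
    ((∑ k ∈ Finset.range m, ℓ k * (θ (k + 1) - θ k)) * ‖U (ξ - ξ₀)‖ - f₀) * ‖U (ξ - ξ₀)‖ ≤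
      ∑ bb ∈ B, (‖latPt U hexFrame bb + U (hcpShift + ξ)‖⁻¹ ^ 8 - ‖latPt U hexFrame bb + U (hcpShift + ξ)‖⁻¹ ^ 14) *
        ⟪latPt U hexFrame bb + U (hcpShift + ξ), U (ξ - ξ₀)⟫ := by
  have hpt : ∀ bb : Fin 3 → ℤ, latPt U hexFrame bb + U (hcpShift + ξ₀) + U (ξ - ξ₀) = latPt U hexFrame bb + U (hcpShift + ξ) := by
    intro bb
    rw [add_assoc, ← map_add]
    congr 2
    abel
  have e0 : ∑ bb ∈ B, segG (fun x : ℝ => x⁻¹ ^ 7 - x⁻¹ ^ 13) (latPt U hexFrame bb + U (hcpShift + ξ₀)) (U (ξ - ξ₀)) 0 =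
      ∑ bb ∈ B, (‖latPt U hexFrame bb + U (hcpShift + ξ₀)‖⁻¹ ^ 8 - ‖latPt U hexFrame bb + U (hcpShift + ξ₀)‖⁻¹ ^ 14) *
        ⟪latPt U hexFrame bb + U (hcpShift + ξ₀), U (ξ - ξ₀)⟫ :=
    Finset.sum_congr rfl fun bb _ => segG_ljProfile_zero _ _
  have e1 : ∑ bb ∈ B, segG (fun x : ℝ => x⁻¹ ^ 7 - x⁻¹ ^ 13) (latPt U hexFrame bb + U (hcpShift + ξ₀)) (U (ξ - ξ₀)) 1 =
      ∑ bb ∈ B, (‖latPt U hexFrame bb + U (hcpShift + ξ)‖⁻¹ ^ 8 - ‖latPt U hexFrame bb + U (hcpShift + ξ)‖⁻¹ ^ 14) *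
        ⟪latPt U hexFrame bb + U (hcpShift + ξ), U (ξ - ξ₀)⟫ := by
    refine Finset.sum_congr rfl fun bb _ => ?_
    rw [segG_ljProfile_one, hpt]
  have hgrow := hcpForce_growth_pieces B hU hξ₀ hξ continuousOn_ljProfile (fun r hr => hasDerivAt_ljProfile (lt_trans (by norm_num) hr).ne')
    m θ ℓ hθ0 hθm hmono hfloor
  rw [e0, e1] at hgrow
  have h0 := (abs_le.1 hf₀).1
  nlinarith [hgrow, h0]

/-- ★★★ **THE `hver` CONCLUSION OF A SLAB LEAF WHOSE EXTERIOR IS CERTIFIED BY A CHAIN OF BOX FLOORS** (nested boxes around the cell, E2′; or the annulus (β)):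
with `Λ := Σ_{k<m} ℓ k (θ (k+1) − θ k)` and `q := Λ‖U(ξ − ξ₀)‖²`, the in-slab coverage hypothesis gives the leaf conclusion for `(U, ξ)`. [folklore chaining:
`hcpForceLJ_exterior_pieces` + `hver_of_slabParts_of_targetForce`] -/
theorem hver_of_slabParts_pieces {μ : ℤ} {U : E3 →L[ℝ] E3} {ξ₀ ξ : E3} (hU : ‖U - 1‖ ≤ 1 / 4) (hξ₀ : ‖ξ₀‖ ≤ 1 / 4) (hξ : ‖ξ‖ ≤ 1 / 4)
    (B R : Finset (Fin 3 → ℤ)) (hB : B ⊆ Fintype.piFinset fun _ : Fin 3 => Finset.Icc (-11 : ℤ) 11)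
    (hBin : ∀ bb ∈ B, ‖latPt U hexFrame bb + U (hcpShift + ξ)‖ ≤ 7)
    (hR : ∀ bb ∈ (Fintype.piFinset fun _ : Fin 3 => Finset.Icc (-11 : ℤ) 11) \ B, ‖latPt U hexFrame bb + U (hcpShift + ξ)‖ ≤ 7 →
      bb ∈ R ∧ 6 ≤ ‖latPt U hexFrame bb + U (hcpShift + ξ)‖)
    (m : ℕ) (θ ℓ : ℕ → ℝ) (hθ0 : θ 0 = 0) (hθm : θ m = 1) (hmono : ∀ k, k < m → θ k ≤ θ (k + 1)) {f₀ : ℝ}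
    (hfloor : ∀ k, k < m → ∀ s ∈ Set.Ioo (θ k) (θ (k + 1)), ℓ k * ‖U (ξ - ξ₀)‖ ^ 2 ≤
      ∑ bb ∈ B, segGd (fun x : ℝ => x⁻¹ ^ 7 - x⁻¹ ^ 13) (latPt U hexFrame bb + U (hcpShift + ξ₀)) (U (ξ - ξ₀)) s)
    (hf₀ : |∑ bb ∈ B, (‖latPt U hexFrame bb + U (hcpShift + ξ₀)‖⁻¹ ^ 8 - ‖latPt U hexFrame bb + U (hcpShift + ξ₀)‖⁻¹ ^ 14) *
        ⟪latPt U hexFrame bb + U (hcpShift + ξ₀), U (ξ - ξ₀)⟫| ≤ f₀ * ‖U (ξ - ξ₀)‖)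
    (hslab : (∑ k ∈ Finset.range m, ℓ k * (θ (k + 1) - θ k)) * ‖U (ξ - ξ₀)‖ ^ 2 ≤ ((6000 / 343 * (7 : ℝ)⁻¹ ^ 4 + 2880 / 49 * (7 : ℝ)⁻¹ ^ 5 +
        10 / 7 * (7 : ℝ)⁻¹ ^ 6 + 2 * (7 : ℝ)⁻¹ ^ 7) + f₀ + R.card * (6 : ℝ)⁻¹ ^ 7) * ‖U (ξ - ξ₀)‖ →
      (∀ (M : ℕ) (z : Fin M → E3) (cc : Fin M), Function.Injective z →
          Set.range z = {x : E3 | dist x (z cc) ≤ 133 / 10 ∧ ∃ a : Fin 3 → ℤ,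
            x = z cc + latPt U hexFrame a ∨ x = z cc + latPt U hexFrame a + U (hcpShift + ξ)} →
          TightNearCap (9 / 5) (3 / 2) z cc ∨ ExemptNear (9 / 5) ExRec z cc ∨ BadNearCap (9 / 5) (3 / 2) z cc) ∨
        (μ : ℝ) / SC ≤ ∑ b ∈ (Fintype.piFinset fun _ : Fin 3 => Finset.Icc (-7 : ℤ) 7).filter (fun b => b ≠ 0), effPot w₄₅ ω₄ (3 / 400) ‖latPt U hexFrame b‖ +
          ∑ b ∈ (Fintype.piFinset fun _ : Fin 3 => Finset.Icc (-7 : ℤ) 7), effPot w₄₅ ω₄ (3 / 400) ‖latPt U hexFrame b + U (hcpShift + ξ)‖) :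
    (∀ (M : ℕ) (z : Fin M → E3) (cc : Fin M), Function.Injective z →
        Set.range z = {x : E3 | dist x (z cc) ≤ 133 / 10 ∧ ∃ a : Fin 3 → ℤ,
          x = z cc + latPt U hexFrame a ∨ x = z cc + latPt U hexFrame a + U (hcpShift + ξ)} →
        TightNearCap (9 / 5) (3 / 2) z cc ∨ ExemptNear (9 / 5) ExRec z cc ∨ BadNearCap (9 / 5) (3 / 2) z cc) ∨
      (μ : ℝ) / SC ≤ ∑ b ∈ (Fintype.piFinset fun _ : Fin 3 => Finset.Icc (-7 : ℤ) 7).filter (fun b => b ≠ 0), effPot w₄₅ ω₄ (3 / 400) ‖latPt U hexFrame b‖ +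
        ∑ b ∈ (Fintype.piFinset fun _ : Fin 3 => Finset.Icc (-7 : ℤ) 7), effPot w₄₅ ω₄ (3 / 400) ‖latPt U hexFrame b + U (hcpShift + ξ)‖ := by
  have hext := hcpForceLJ_exterior_pieces B hU hξ₀ hξ m θ ℓ hθ0 hθm hmono hfloor hf₀
  refine hver_of_slabParts_of_targetForce (μ := μ) hU hξ B R hB hBin hR
    (q := (∑ k ∈ Finset.range m, ℓ k * (θ (k + 1) - θ k)) * ‖U (ξ - ξ₀)‖ ^ 2) ?_ ?_ hslab
  · intro h0
    rw [h0, norm_zero]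
    simp
  · by_cases hΔ0 : U (ξ - ξ₀) = 0
    · rw [hΔ0]
      simp
    · have hpos : 0 < ‖U (ξ - ξ₀)‖ := norm_pos_iff.2 hΔ0
      have h1 : (∑ k ∈ Finset.range m, ℓ k * (θ (k + 1) - θ k)) * ‖U (ξ - ξ₀)‖ ^ 2 / ‖U (ξ - ξ₀)‖ =
          (∑ k ∈ Finset.range m, ℓ k * (θ (k + 1) - θ k)) * ‖U (ξ - ξ₀)‖ := by
        field_simp
      rw [h1]
      exact hext

end Summit.AtomisticToContinuum.Crystallization.Theorems.FrustratedLawDichotomyStrainedPatchHomExteriorTaylor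

end
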